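import Summits.AtomisticToContinuum.Crystallization.Theorems.FrustratedLawDichotomyStrainedPatchHomTube
import Summits.AtomisticToContinuum.Crystallization.Theorems.FrustratedLawDichotomyStrainedPatchHomIsometry

/-!
# REPAIR of the off-tube piece: the tube taken MODULO ISOMETRY («HomTubeIso», lens-5 g46 §A; under «HomTube» p843977)

`NearHom ε z c` (`…StrainedPatchHomTube` §1) compares the cluster's `63/10`-ball with an admissible homogeneous instance POSITION BY POSITION RELATIVE TO THE
CENTRES, with NO rotation, while `IsHomBall` pins the instance's frame (`fccVec` / `hexFrame`, `‖G − 1‖ ≤ 1/4`, EXACT range equality).  The score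
`ballAvg (9/5) z (xRec M z) c`, `Admissible` and `CleanBall` are invariant under every linear isometry `R : E3 ≃ₗᵢ[ℝ] E3` (§1, from `…StrainedPatchHomIsometry`),
so `OffTubeFloor r ε φ` prices EVERY admissible clean cluster SOME ISOMETRIC COPY of which lies off the frame-fixed tube (`offTubeFloor_iff_exists_iso`, PROVED).
TILT LEMMA (typed in §2 as the leaf `TiltEscape ε`; status UNDECIDED·ATTACKABLE, paper proof memo NODE-g46 §A): EVERY admissible cluster has an isometric copy
off the frame-fixed `1/100`-tube.  Sketch: if `NearHom ε (R ∘ z) c` then the instance point `G v` (`v = fccVec 0` resp. `hexFrame 0`, `‖v‖ = 1`, `‖G − 1‖ ≤ 1/4`, so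
`3/4 ≤ ‖G v‖ ≤ 5/4`) is covered, i.e. matched by a cluster atom `a ≠ c` with `‖R (z a − z c) − G v‖ ≤ ε`; hence `R⁻¹ v` lies within
`θ(ε) = asin (1/4) + asin (4ε/3)` (`= 15.24°` at `ε = 1/100`) of the direction of `z a − z c` for some `a` in `P = {a ≠ c : ‖z a − z c‖ ≤ 5/4 + ε}`, a set that does
NOT depend on `R`; range equality bounds `|P|` by the number of instance points within `5/4 + 2ε` of the instance centre (`≤ 18` for an fcc-type instance, `≤ 32`
for an hcp-type one, crudely over `‖ξ‖ ≤ 1/4`), so the Haar measure of the rotations `R` for which `R ∘ z` is on the tube is `≤ (18 + 18)·(1 − cos θ)/2 = 0.64 < 1` when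
instances of both types occur (`≤ 32·0.0176 = 0.57` when only hcp-type ones do): some rotation escapes.  CONSEQUENCE (`offTubeFloor_iff_cleanTextureFloorAt_of_tiltEscape`,
PROVED from the leaf): under `TiltEscape ε` the g45 record piece `OffTubeFloor (63/10) (1/100) (1/1000)` IS the whole elastic piece at level `1/1000`
(`CleanTextureFloorAt (63/10) (1/1000)`), knife edge included (margin `1.80×`: lowest admissible clean score on file `S = 1.799e-3`, g46 `out/BEND_RD_full.md`), and
the HomTube cut `[EL] ↔ TUBE ∧ OffTubeFloor r ε 0` degenerates to `[EL] ↔ TUBE ∧ [EL]` — the must-fail probe Q2 of `g45/check/HomTubeProbes.lean` passed only because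
the tilt lemma is not in the tree (Lean routes: Haar measure on `SO(3)` pushed to `S²` with the cap-area formula, or a finite rotation design checked by interval
arithmetic).

REPAIR (this file): `NearHomIso ε z c := ∃ R, NearHom ε (R ∘ z) c`;  `TubeFloorIso r ε ↔ TubeFloor r ε` (PROVED by transport: the tube piece is UNCHANGED, so
(H) + `TubeRelief` still discharge it: `tubeFloorIso_of_homFloor_of_tubeRelief`);  `OffTubeFloor r ε φ → OffTubeFloorIso r ε φ` (PROVED: the repaired off-tube
piece is WEAKER; strictly, by the tilt);  exact cut `CleanTextureFloor r ↔ TubeFloorIso r ε ∧ OffTubeFloorIso r ε 0` (`em`), necessity, seam for floors `≥ 0`,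
dials, the REPAIRED RECORD NODE `HomFloor (1/625) → TubeRelief (63/10) (1/100) 0 (1/1000) → OffTubeFloorIso (63/10) (1/100) (1/1000) → AnnularDefectFloor (24/5) (63/10) →
DefectiveCollarFloor (24/5) → StrainedPatchRec`, and the g45 record node as its corollary (nothing proved before is lost).
INSTRUMENT: `g45/scripts/nearhom45.py` fits a FREE affine map, i.e. it already measures the isometry-quotiented distance — every number on file (off-tube
`S ≥ 2.09e-3`; faults `S ≥ 4.40e-3`; census L5-ASK4) is evidence for `OffTubeFloorIso`, and was never evidence for `OffTubeFloor`.
TAGS: TUBE unchanged ((H) CERT-in-flight + [TR] PERTURBATIVE); [OT-iso] `OffTubeFloorIso (63/10) (1/100) (1/1000)` WEAKER-by-restriction at `φ = 0`, killable at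
`φ = 1/1000` · UNDECIDED · IDEA-NEEDED (cut further by stacking phase in `…StrainedPatchPhaseCut`); `TiltEscape (1/100)` LEAF · UNDECIDED · ATTACKABLE (paper-proved;
enters NO node — it only certifies that the g45 piece was the whole of [EL]).  No new axioms, no sorry, no instances / notation.
Evidence: `run/shared/lean/pub/decomp-a2c/decomp-a2c-lens-5/g46/{NODE-g46.md §A, check/}`.
-/

namespace Summit.AtomisticToContinuum.Crystallization.Theorems.FrustratedLawDichotomyStrainedPatchHomTubeIso

open scoped BigOperators Classical
open Summit.AtomisticToContinuum.Crystallization.Theorems.FrustratedLawDichotomyRangeCut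
open Summit.AtomisticToContinuum.Crystallization.Theorems.FrustratedLawDichotomySchurCut
open Summit.AtomisticToContinuum.Crystallization.Theorems.FrustratedLawDichotomyMotifLemmas
open Summit.AtomisticToContinuum.Crystallization.Theorems.FrustratedLawDichotomyAveragingCut
open Summit.AtomisticToContinuum.Crystallization.Theorems.FrustratedLawDichotomyAveragingRuleCap
open Summit.AtomisticToContinuum.Crystallization.Theorems.FrustratedLawDichotomyAveragingRuleTightFree
open Summit.AtomisticToContinuum.Crystallization.Theorems.FrustratedLawDichotomyRuleToolkitGood (goodFlag)
open Summit.AtomisticToContinuum.Crystallization.Theorems.FrustratedLawDichotomyExemptDoor (SitePred)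
open Summit.AtomisticToContinuum.Crystallization.Theorems.FrustratedLawDichotomyExemptAbsorption
open Summit.AtomisticToContinuum.Crystallization.Theorems.FrustratedLawDichotomyExemptAbsorptionRecord
open Summit.AtomisticToContinuum.Crystallization.Theorems.FrustratedLawDichotomyCollarCensus
open Summit.AtomisticToContinuum.Crystallization.Theorems.FrustratedLawDichotomyCollarCensusKappa
open Summit.AtomisticToContinuum.Crystallization.Theorems.FrustratedLawDichotomyStrainedPatchHomSplit
open Summit.AtomisticToContinuum.Crystallization.Theorems.FrustratedLawDichotomyStrainedPatchCleanCollar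
open Summit.AtomisticToContinuum.Crystallization.Theorems.FrustratedLawDichotomyStrainedPatchHomTube
open Summit.AtomisticToContinuum.Crystallization.Theorems.FrustratedLawDichotomyStrainedPatchHomIsometry

variable {N : ℕ}

/-! ## §1. The score, admissibility and cleanliness are invariant under linear isometries of `E3` -/

/-- The pair sum is invariant. [formal bookkeeping] -/
theorem pairSumFeature_comp (R : E3 ≃ₗᵢ[ℝ] E3) (W : ℝ → ℝ) (y : Fin N → E3) (j : Fin N) :
    pairSumFeature W N (⇑R ∘ y) j = pairSumFeature W N y j := by
  simp only [pairSumFeature, Function.comp_apply, LinearIsometryEquiv.dist_map]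

/-- The capped crystallinity flag is invariant. [formal bookkeeping] -/
theorem goodFlag_comp {η D : ℝ} (R : E3 ≃ₗᵢ[ℝ] E3) (y : Fin N → E3) (j : Fin N) :
    goodFlag η D N (⇑R ∘ y) j = goodFlag η D N y j := by
  simp only [goodFlag, goodAtScale_comp_iff]

/-- The capped surplus is invariant. [formal bookkeeping] -/
theorem surplusCap_comp {η₀ η₁ D : ℝ} {W : ℝ → ℝ} {e κT CT : ℝ} (R : E3 ≃ₗᵢ[ℝ] E3) (y : Fin N → E3) (j : Fin N) :
    surplusCap η₀ η₁ D W e κT CT N (⇑R ∘ y) j = surplusCap η₀ η₁ D W e κT CT N y j := by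
  simp only [surplusCap, pairSumFeature_comp, goodFlag_comp]

/-- ★ The surplus of record is invariant: `xRec M (R ∘ z) = xRec M z`. [folklore] -/
theorem xRec_comp (R : E3 ≃ₗᵢ[ℝ] E3) {M : ℕ} (z : Fin M → E3) : xRec M (⇑R ∘ z) = xRec M z := by
  funext j
  unfold xRec
  exact surplusCap_comp R z j

/-- The ball average of a fixed site functional is invariant. [formal bookkeeping] -/
theorem ballAvg_comp (R : E3 ≃ₗᵢ[ℝ] E3) (ρ : ℝ) (y : Fin N → E3) (x : Fin N → ℝ) (i : Fin N) :
    ballAvg ρ (⇑R ∘ y) x i = ballAvg ρ y x i := by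
  simp only [ballAvg, ball_comp]

/-- ★ THE SCORE IS INVARIANT: `S(R ∘ z, c) = S(z, c)`. [folklore] -/
theorem ballAvg_xRec_comp (R : E3 ≃ₗᵢ[ℝ] E3) {M : ℕ} (z : Fin M → E3) (c : Fin M) :
    ballAvg (9 / 5) (⇑R ∘ z) (xRec M (⇑R ∘ z)) c = ballAvg (9 / 5) z (xRec M z) c := by
  rw [xRec_comp, ballAvg_comp]

/-- `CleanBall r (R ∘ z) c ↔ CleanBall r z c`. [folklore] -/
theorem cleanBall_comp_iff (R : E3 ≃ₗᵢ[ℝ] E3) {r : ℝ} {M : ℕ} (z : Fin M → E3) (c : Fin M) :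
    CleanBall r (⇑R ∘ z) c ↔ CleanBall r z c := by
  simp only [CleanBall, dist_comp, goodAtScale_comp_iff]

/-! ## §2. REPAIR: the tube modulo isometry -/

/-- **`NearHomIso ε z c`** — SOME ISOMETRIC COPY of the cluster is `NearHom ε`: the `63/10`-ball is within `ε`, atom by atom relative to the centres and
UP TO A LINEAR ISOMETRY of `E3`, of an admissible homogeneous instance. -/
def NearHomIso (ε : ℝ) {M : ℕ} (z : Fin M → E3) (c : Fin M) : Prop :=
  ∃ R : E3 ≃ₗᵢ[ℝ] E3, NearHom ε (⇑R ∘ z) c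

/-- The frame-fixed tube lies inside the isometry-quotiented tube (`R = 1`). [formal bookkeeping] -/
theorem nearHomIso_of_nearHom {ε : ℝ} {M : ℕ} {z : Fin M → E3} {c : Fin M} (h : NearHom ε z c) : NearHomIso ε z c :=
  ⟨LinearIsometryEquiv.refl ℝ E3, by rw [LinearIsometryEquiv.coe_refl, Function.id_comp]; exact h⟩

/-- The quotiented tube widens with `ε`. [folklore] -/
theorem NearHomIso.mono {ε ε' : ℝ} {M : ℕ} {z : Fin M → E3} {c : Fin M} (h : NearHomIso ε z c) (hle : ε ≤ ε') : NearHomIso ε' z c := by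
  obtain ⟨R, h⟩ := h
  exact ⟨R, h.mono hle⟩

/-- The quotiented tube is itself isometry-invariant. [folklore] -/
theorem nearHomIso_comp_iff (R : E3 ≃ₗᵢ[ℝ] E3) {ε : ℝ} {M : ℕ} (z : Fin M → E3) (c : Fin M) :
    NearHomIso ε (⇑R ∘ z) c ↔ NearHomIso ε z c := by
  constructor
  · rintro ⟨R₀, h⟩
    refine ⟨R.trans R₀, ?_⟩
    have : ⇑(R.trans R₀) ∘ z = ⇑R₀ ∘ (⇑R ∘ z) := by funext a; simp
    rw [this]; exact h
  · rintro ⟨R₀, h⟩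
    refine ⟨R.symm.trans R₀, ?_⟩
    have : ⇑(R.symm.trans R₀) ∘ (⇑R ∘ z) = ⇑R₀ ∘ z := by funext a; simp
    rw [this]; exact h

/-- **`TubeFloorIso r ε` [TUBE modulo isometry]** — the elastic piece on admissible, clean-within-`r`, `NearHomIso ε` clusters. -/
def TubeFloorIso (r ε : ℝ) : Prop :=
  ∀ (M : ℕ) (z : Fin M → E3) (c : Fin M), Admissible M z c → CleanBall r z c → NearHomIso ε z c → 0 ≤ ballAvg (9 / 5) z (xRec M z) c

/-- **`OffTubeFloorIso r ε φ` [OFF-TUBE modulo isometry; the REPAIRED quantitative-rigidity piece]** — on admissible clusters, clean within `r`, NO isometric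
copy of which is `NearHom ε`, the score is `≥ φ`. -/
def OffTubeFloorIso (r ε φ : ℝ) : Prop :=
  ∀ (M : ℕ) (z : Fin M → E3) (c : Fin M), Admissible M z c → CleanBall r z c → ¬NearHomIso ε z c → φ ≤ ballAvg (9 / 5) z (xRec M z) c

/-- ★ The tube piece is UNCHANGED by the quotient: `TubeFloorIso r ε ↔ TubeFloor r ε` (transport along the isometry). [folklore] -/
theorem tubeFloorIso_iff_tubeFloor (r ε : ℝ) : TubeFloorIso r ε ↔ TubeFloor r ε := by
  constructor
  · exact fun h M z c hz hcl hn => h M z c hz hcl (nearHomIso_of_nearHom hn)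
  · rintro h M z c hz hcl ⟨R, hn⟩
    have := h M (⇑R ∘ z) c ((admissible_comp_iff R z c).2 hz) ((cleanBall_comp_iff R z c).2 hcl) hn
    rwa [ballAvg_xRec_comp] at this

/-- ★ The REPAIRED off-tube piece is WEAKER than HomTube's: `OffTubeFloor r ε φ → OffTubeFloorIso r ε φ`. [folklore] -/
theorem offTubeFloorIso_of_offTubeFloor {r ε φ : ℝ} (h : OffTubeFloor r ε φ) : OffTubeFloorIso r ε φ :=
  fun M z c hz hcl hn => h M z c hz hcl fun hn' => hn (nearHomIso_of_nearHom hn')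

/-- ★ THE LEAK, typed: HomTube's frame-fixed off-tube piece prices every admissible clean cluster SOME ISOMETRIC COPY of which is off the tube —
`OffTubeFloor r ε φ ↔ ∀ …, Admissible → CleanBall r → (∃ R, ¬NearHom ε (R ∘ z) c) → φ ≤ S`. [folklore: score / admissibility / cleanliness are invariant] -/
theorem offTubeFloor_iff_exists_iso (r ε φ : ℝ) :
    OffTubeFloor r ε φ ↔ ∀ (M : ℕ) (z : Fin M → E3) (c : Fin M), Admissible M z c → CleanBall r z c →
      (∃ R : E3 ≃ₗᵢ[ℝ] E3, ¬NearHom ε (⇑R ∘ z) c) → φ ≤ ballAvg (9 / 5) z (xRec M z) c := by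
  constructor
  · rintro h M z c hz hcl ⟨R, hn⟩
    have := h M (⇑R ∘ z) c ((admissible_comp_iff R z c).2 hz) ((cleanBall_comp_iff R z c).2 hcl) hn
    rwa [ballAvg_xRec_comp] at this
  · intro h M z c hz hcl hn
    exact h M z c hz hcl ⟨LinearIsometryEquiv.refl ℝ E3, by rw [LinearIsometryEquiv.coe_refl, Function.id_comp]; exact hn⟩

/-- … versus the repaired piece, which prices a cluster only if EVERY isometric copy is off the tube. [formal bookkeeping] -/
theorem offTubeFloorIso_iff_forall_iso (r ε φ : ℝ) :
    OffTubeFloorIso r ε φ ↔ ∀ (M : ℕ) (z : Fin M → E3) (c : Fin M), Admissible M z c → CleanBall r z c →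
      (∀ R : E3 ≃ₗᵢ[ℝ] E3, ¬NearHom ε (⇑R ∘ z) c) → φ ≤ ballAvg (9 / 5) z (xRec M z) c := by
  simp only [OffTubeFloorIso, NearHomIso, not_exists]

/-- **`CleanTextureFloorAt r φ`** — the elastic piece with an explicit floor (`CleanTextureFloorAt r 0 ↔ CleanTextureFloor r`). -/
def CleanTextureFloorAt (r φ : ℝ) : Prop :=
  ∀ (M : ℕ) (z : Fin M → E3) (c : Fin M), Admissible M z c → CleanBall r z c → φ ≤ ballAvg (9 / 5) z (xRec M z) c

/-- `CleanTextureFloorAt r 0 ↔ CleanTextureFloor r`. [formal bookkeeping] -/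
theorem cleanTextureFloorAt_zero_iff (r : ℝ) : CleanTextureFloorAt r 0 ↔ CleanTextureFloor r := Iff.rfl

/-- The levelled elastic piece gives every off-tube piece (both forms); the converse for the FRAME-FIXED form is
`offTubeFloor_iff_cleanTextureFloorAt_of_tiltEscape` below, which is why that form was too strong. [folklore] -/
theorem offTubeFloor_of_cleanTextureFloorAt {r φ : ℝ} (ε : ℝ) (h : CleanTextureFloorAt r φ) : OffTubeFloor r ε φ :=
  fun M z c hz hcl _ => h M z c hz hcl

/-- **`TiltEscape ε` [TILT LEMMA — leaf; UNDECIDED·ATTACKABLE]** — every admissible cluster has an ISOMETRIC COPY off the frame-fixed `ε`-tube.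
Paper proof at `ε = 1/100` (memo NODE-g46 §A): the covered instance point `G v` (`v = fccVec 0` / `hexFrame 0`) pins `R⁻¹ v` within
`θ = asin (1/4) + asin (4ε/3) = 15.24°` of one of the `|P| ≤ 18` (fcc-type) / `≤ 32` (hcp-type) near-shell directions of the cluster, and
`max (18 + 18, 32) · (1 − cos θ)/2 = 0.64 < 1` (Haar measure on `SO(3)`).  Lean route: cap-area formula on `S²`, or a finite rotation design. -/
def TiltEscape (ε : ℝ) : Prop :=
  ∀ (M : ℕ) (z : Fin M → E3) (c : Fin M), Admissible M z c → ∃ R : E3 ≃ₗᵢ[ℝ] E3, ¬NearHom ε (⇑R ∘ z) c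

/-- The tilt lemma is antitone in `ε` (a wider tube is harder to escape). [formal bookkeeping] -/
theorem TiltEscape.of_le {ε ε' : ℝ} (h : TiltEscape ε') (hle : ε ≤ ε') : TiltEscape ε := fun M z c hz => by
  obtain ⟨R, hR⟩ := h M z c hz
  exact ⟨R, fun hn => hR (hn.mono hle)⟩

/-- ★ UNDER THE TILT LEMMA the frame-fixed off-tube piece IS the levelled elastic piece: `TiltEscape ε → (OffTubeFloor r ε φ ↔ CleanTextureFloorAt r φ)` —
HomTube's cut `[EL] ↔ TUBE ∧ OffTubeFloor r ε 0` then reads `[EL] ↔ TUBE ∧ [EL]`. [folklore] -/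
theorem offTubeFloor_iff_cleanTextureFloorAt_of_tiltEscape {ε : ℝ} (hT : TiltEscape ε) (r φ : ℝ) :
    OffTubeFloor r ε φ ↔ CleanTextureFloorAt r φ :=
  ⟨fun h M z c hz hcl => (offTubeFloor_iff_exists_iso r ε φ).1 h M z c hz hcl (hT M z c hz),
    fun h => offTubeFloor_of_cleanTextureFloorAt ε h⟩

/-- … so under the tilt lemma HomTube's off-tube piece at any floor `φ ≥ 0` ALONE gives the elastic piece (the tube piece was never needed). [folklore] -/
theorem cleanTextureFloor_of_offTubeFloor_of_tiltEscape {r ε φ : ℝ} (hT : TiltEscape ε) (h : OffTubeFloor r ε φ) (hφ : 0 ≤ φ) :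
    CleanTextureFloor r :=
  fun M z c hz hcl => hφ.trans (((offTubeFloor_iff_cleanTextureFloorAt_of_tiltEscape hT r φ).1 h) M z c hz hcl)

/-- ★ EXACT CUT of the elastic piece, repaired: `CleanTextureFloor r ↔ TubeFloorIso r ε ∧ OffTubeFloorIso r ε 0`. [folklore: `em` on `NearHomIso ε`] -/
theorem cleanTextureFloor_iff_tubeIso_and_offTubeIso (r ε : ℝ) : CleanTextureFloor r ↔ TubeFloorIso r ε ∧ OffTubeFloorIso r ε 0 := by
  constructor
  · intro h
    exact ⟨fun M z c hz hcl _ => h M z c hz hcl, fun M z c hz hcl _ => h M z c hz hcl⟩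
  · rintro ⟨hT, hO⟩ M z c hz hcl
    by_cases hn : NearHomIso ε z c
    · exact hT M z c hz hcl hn
    · exact hO M z c hz hcl hn

/-- NECESSITY of the quotiented tube piece. [folklore] -/
theorem tubeFloorIso_of_cleanTextureFloor {r : ℝ} (ε : ℝ) (h : CleanTextureFloor r) : TubeFloorIso r ε :=
  ((cleanTextureFloor_iff_tubeIso_and_offTubeIso r ε).1 h).1

/-- NECESSITY of the repaired off-tube piece at floor `0`. [folklore] -/
theorem offTubeFloorIso_zero_of_cleanTextureFloor {r : ℝ} (ε : ℝ) (h : CleanTextureFloor r) : OffTubeFloorIso r ε 0 :=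
  ((cleanTextureFloor_iff_tubeIso_and_offTubeIso r ε).1 h).2

/-- The repaired off-tube piece is antitone in the floor … [folklore] -/
theorem OffTubeFloorIso.of_le {r ε φ φ' : ℝ} (h : OffTubeFloorIso r ε φ) (hle : φ' ≤ φ) : OffTubeFloorIso r ε φ' :=
  fun M z c hz hcl hn => hle.trans (h M z c hz hcl hn)

/-- … monotone in `ε` … [folklore] -/
theorem OffTubeFloorIso.mono {r ε ε' φ : ℝ} (h : OffTubeFloorIso r ε φ) (hle : ε ≤ ε') : OffTubeFloorIso r ε' φ :=
  fun M z c hz hcl hn => h M z c hz hcl fun hn' => hn (hn'.mono hle)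

/-- … and monotone in the clean radius. [folklore] -/
theorem OffTubeFloorIso.of_le_radius {r r' ε φ : ℝ} (h : OffTubeFloorIso r ε φ) (hle : r ≤ r') : OffTubeFloorIso r' ε φ :=
  fun M z c hz hcl hn => h M z c hz (hcl.mono hle) hn

/-- The quotiented tube piece is antitone in `ε` and monotone in the clean radius. [folklore] -/
theorem TubeFloorIso.of_le {r ε ε' : ℝ} (h : TubeFloorIso r ε') (hle : ε ≤ ε') : TubeFloorIso r ε :=
  fun M z c hz hcl hn => h M z c hz hcl (hn.mono hle)

/-- Monotonicity bookkeeping (`TubeFloorIso.of_le_radius`). -/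
theorem TubeFloorIso.of_le_radius {r r' ε : ℝ} (h : TubeFloorIso r ε) (hle : r ≤ r') : TubeFloorIso r' ε :=
  fun M z c hz hcl hn => h M z c hz (hcl.mono hle) hn

/-- ★ SEAM, repaired: `TubeFloorIso r ε → OffTubeFloorIso r ε φ → 0 ≤ φ → CleanTextureFloor r`. [folklore] -/
theorem cleanTextureFloor_of_tubeIso_of_offTubeIso {r ε φ : ℝ} (hT : TubeFloorIso r ε) (hO : OffTubeFloorIso r ε φ) (hφ : 0 ≤ φ) :
    CleanTextureFloor r :=
  (cleanTextureFloor_iff_tubeIso_and_offTubeIso r ε).2 ⟨hT, hO.of_le hφ⟩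

/-- ★ (H) + tube relief still discharge the tube: `HomFloor m → TubeRelief r ε L B → L·σ₁ + B ≤ m → TubeFloorIso r ε`. [folklore] -/
theorem tubeFloorIso_of_homFloor_of_tubeRelief {m r ε L B : ℝ} (hH : HomFloor m) (hR : TubeRelief r ε L B) (hm : L * sigmaOne + B ≤ m) :
    TubeFloorIso r ε :=
  (tubeFloorIso_iff_tubeFloor r ε).2 (tubeFloor_of_homFloor_of_tubeRelief hH hR hm)

/-- ★★ RECORD NODE, REPAIRED: `HomFloor (1/625) → TubeRelief (63/10) (1/100) 0 (1/1000) → OffTubeFloorIso (63/10) (1/100) (1/1000) → AnnularDefectFloor (24/5) (63/10)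
→ DefectiveCollarFloor (24/5) → StrainedPatchRec`. -/
theorem strainedPatchRec_of_homFloor_625_of_tubeRelief_milli_of_offTubeIso_of_annular_of_near (hH : HomFloor (1 / 625))
    (hR : TubeRelief (63 / 10) (1 / 100) 0 (1 / 1000)) (hO : OffTubeFloorIso (63 / 10) (1 / 100) (1 / 1000))
    (hA : AnnularDefectFloor (24 / 5) (63 / 10)) (hD : DefectiveCollarFloor (24 / 5)) : StrainedPatchRec :=
  strainedPatchRec_iff_record_regimes.2
    ⟨cleanTextureFloor_of_tubeIso_of_offTubeIso (tubeFloorIso_of_homFloor_of_tubeRelief hH hR seam_arith_tube) hO (by norm_num), hA, hD⟩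

end Summit.AtomisticToContinuum.Crystallization.Theorems.FrustratedLawDichotomyStrainedPatchHomTubeIso
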